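import Summits.BirchSwinnertonDyer.Rank1Residual.X11b.RouteR1IntReceptacle
import HarnessLib

/-!
# X11b, route p2 — ♭-infrastructure (every `p`): CONTINUITY AT `T = 0` of the values of an element
# `Q ∈ 𝓞_{ℂ_p}⟦T⟧` — `‖Q(x) − Q(0)‖ ≤ ‖x‖` on the closed unit disc, and the value at `𝟙` as the LIMIT
# of values along interpolation points `x_k → 0` (cell `b2b-bsdres`, sub-cell `multr1-p2`, gen 24)

HONEST FRAMING (cell `b2b-bsdres`, run/shared/lean/b2b/bsd-rank1-residual/, verbatim in every
file): the goal of the cell is to DELETE the COMBINATION-SHAPED residual classes of the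
Birch–Swinnerton-Dyer formula for ALL analytic-rank `≤ 1` elliptic curves over `ℚ` — "full BSD
formula for every rank `≤ 1` curve in class `C`" assembled STRICTLY from published theorems — so
that the rank-`≤ 1` remainder becomes exactly the CONSTRUCTION-SHAPED classes, which are TYPED
(missing-input `Prop`s), NOT attempted. This is not "finishing BSD". Sub-cell `multr1-p2` is a
RESEARCH ROUTE on class X11b; no claim beyond the stated class and loci; X11b's label does not
change; NOTHING is booked by this file.

THEOREMS ONLY (no definition, no named fact, no `sorry`); elementary ultrametric analysis on Hsieh's
receptacle `𝓞_{ℂ_p}⟦T⟧` (values through `IntSeries.HasValueAt`, x11b3-lit1's currency).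

## Why (gen 24; the successor's trigger for conjunct 3.2♭ off the semistable pairs)

Route p2's typed open input is H∃♭ `P2.IMCDivIntFrameOnTree` (`BDPRouteOpenInputIntFrame.lean`): one
frame `Q ∈ 𝓞_{ℂ_p}⟦T⟧` with [3.1♭] Castella's interpolation property on characters of infinity type
`(n, −n)`, `n ≥ 1`, [3.2♭] the VALUE AT `𝟙` (`T = 0`, outside the interpolation range) and [(2.4)♭].
3.1♭ has a published source on every pair (Hsieh 2014 Thm. 1, `BDPRouteHsiehFrame.lean`); 3.2♭ off
the semistable pairs has in print only [cas-split] Thm. 2.11 (lit GEN 51's reading: split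
multiplicative `p ≥ 5`, any tame level, the `p`-adic `L`-function typed as a CONTINUOUS FUNCTION on
characters with the squared-BDP interpolation, NOT as a `Λ`-valued element). To read a value theorem
about a continuous function into 3.2♭ for a `Λ`-valued frame one needs exactly: (i) the values of
`Q` are CONTINUOUS at `T = 0` — this file — and (ii) interpolation points `x_φ = φ̂(γ) − 1`
accumulating at `0` with the two normalisations' ratio tending to `1` (character supply + period
bookkeeping; x11b3's S27 'V1RIG' at `p = 3`; not here).

* `intSeries_norm_value_sub_constantCoeff_le`: `IntSeries.HasValueAt Q x v`, `‖x‖ ≤ 1` ⟹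
  `‖v − Q(0)‖ ≤ ‖x‖` (ultrametric: `v − Q(0) = Σ_{k≥1} a_k x^k`, every term of norm `≤ ‖x‖`).
* `intSeries_tendsto_value_of_tendsto_zero`: values `v_k` of `Q` at points `x_k → 0` tend to `Q(0)`.
* `intSeries_hasValueAt_zero_of_tendsto`: if moreover `v_k → w` then `Q(𝟙) = w`
  (`IntSeries.HasValueAt Q 0 w`) — the value at the trivial character is DETERMINED by the values on
  any family of points accumulating at `0`; `intSeries_constantCoeff_eq_of_tendsto` (the same as an
  equality `w = Q(0)`).

Nothing here is specific to `p ≥ 5` or to route p2; nothing of team x11b3's `UnrSeries`-typed S27 is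
restated (their statement is over `R₀⟦T⟧` frames at `3`; this is the `𝓞_{ℂ_p}⟦T⟧` receptacle).
No label change; nothing booked.

References: [Hsieh2014] p. 7 (`Λ = Z̄_p⟦Γ⁻⟧ ⊆ 𝓞_{ℂ_p}⟦T⟧`); [Castella2018] §2.2 (values at
`γ ↦ 1 + T`); [Washington1997] §7.1 (power series on the open unit disc).
-/

noncomputable section

open scoped Classical Topology

open Filter PowerSeries
open Literature.NumberTheory.EllipticCurves

namespace Summit.BirchSwinnertonDyer.Rank1Residual.X11b

variable {p : ℕ} [Fact p.Prime]

/-- **`‖Q(x) − Q(0)‖ ≤ ‖x‖` on the closed unit disc** for `Q ∈ 𝓞_{ℂ_p}⟦T⟧`: if `Q` takes the value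
`v` at `x` with `‖x‖ ≤ 1`, then `v − [T⁰]Q = Σ_{k ≥ 1} [T^k]Q · x^k` has norm `≤ ‖x‖` (every term has
norm `≤ ‖x‖^{k+1} ≤ ‖x‖`; the norm of `ℂ_p` is ultrametric). [cite: Washington1997, §7.1] -/
theorem intSeries_norm_value_sub_constantCoeff_le {Q : PowerSeries 𝓞_ℂ_[p]} {x v : ℂ_[p]}
    (hx : ‖x‖ ≤ 1) (h : IntSeries.HasValueAt Q x v) :
    ‖v - ((PowerSeries.constantCoeff Q : 𝓞_ℂ_[p]) : ℂ_[p])‖ ≤ ‖x‖ := by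
  unfold IntSeries.HasValueAt at h
  have h1 := (hasSum_nat_add_iff' 1).mpr h
  rw [Finset.sum_range_one, pow_zero, mul_one, PowerSeries.coeff_zero_eq_constantCoeff] at h1
  rw [← h1.tsum_eq]
  refine IsUltrametricDist.norm_tsum_le_of_forall_le_of_nonneg (norm_nonneg x) fun k ↦ ?_
  rw [norm_mul, norm_pow, pow_succ]
  calc ‖((PowerSeries.coeff (k + 1) Q : 𝓞_ℂ_[p]) : ℂ_[p])‖ * (‖x‖ ^ k * ‖x‖)
      ≤ 1 * (1 * ‖x‖) := by
        gcongr
        · exact R1.norm_coe_padicComplexInt_le_one p _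
        · exact pow_le_one₀ (norm_nonneg _) hx
    _ = ‖x‖ := by ring

/-- **Continuity of the values at `T = 0`**: if `Q ∈ 𝓞_{ℂ_p}⟦T⟧` takes the values `v k` at points
`x k → 0`, then `v k → Q(0) = [T⁰]Q`. [cite: Washington1997, §7.1] -/
theorem intSeries_tendsto_value_of_tendsto_zero {Q : PowerSeries 𝓞_ℂ_[p]} {x v : ℕ → ℂ_[p]}
    (hx : Tendsto x atTop (𝓝 0)) (h : ∀ k, IntSeries.HasValueAt Q (x k) (v k)) :
    Tendsto v atTop (𝓝 ((PowerSeries.constantCoeff Q : 𝓞_ℂ_[p]) : ℂ_[p])) := by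
  set c : ℂ_[p] := ((PowerSeries.constantCoeff Q : 𝓞_ℂ_[p]) : ℂ_[p]) with hc
  rw [tendsto_iff_norm_sub_tendsto_zero]
  have hx' : Tendsto (fun k ↦ ‖x k‖) atTop (𝓝 0) := by
    simpa using (tendsto_iff_norm_sub_tendsto_zero.mp hx)
  -- eventually `‖x k‖ ≤ 1`, where the bound `‖v k − c‖ ≤ ‖x k‖` applies
  have hev : ∀ᶠ k in atTop, ‖v k - c‖ ≤ ‖x k‖ := by
    have h1 : ∀ᶠ k in atTop, ‖x k‖ ≤ 1 := by
      have := hx'.eventually (eventually_le_nhds (show (0 : ℝ) < 1 by norm_num))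
      exact this
    filter_upwards [h1] with k hk
    exact intSeries_norm_value_sub_constantCoeff_le hk (h k)
  exact squeeze_zero' (Eventually.of_forall fun k ↦ norm_nonneg _) hev hx'

/-- **The value at `𝟙` as a LIMIT**: if `Q ∈ 𝓞_{ℂ_p}⟦T⟧` takes the values `v k` at points `x k → 0`
and `v k → w`, then `Q` takes the value `w` at `T = 0` (`IntSeries.HasValueAt Q 0 w`): the value at the
trivial character is determined by the values on any family of points accumulating at `0` (e.g.
interpolation points `φ̂(γ) − 1` of characters of type `(n, −n)` with `n → 0` `p`-adically).
[cite: Washington1997, §7.1] [cite: Hsieh2014, Thm. 1 (arXiv:1112.1580 p. 4)] -/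
theorem intSeries_hasValueAt_zero_of_tendsto {Q : PowerSeries 𝓞_ℂ_[p]} {x v : ℕ → ℂ_[p]}
    {w : ℂ_[p]} (hx : Tendsto x atTop (𝓝 0)) (hv : Tendsto v atTop (𝓝 w))
    (h : ∀ k, IntSeries.HasValueAt Q (x k) (v k)) : IntSeries.HasValueAt Q 0 w := by
  have hlim := intSeries_tendsto_value_of_tendsto_zero hx h
  rw [tendsto_nhds_unique hv hlim]
  exact R1.intSeries_hasValueAt_zero p Q

/-- The same as an equality: the limit of the values IS the constant term. [cite: Washington1997, §7.1] -/
theorem intSeries_constantCoeff_eq_of_tendsto {Q : PowerSeries 𝓞_ℂ_[p]} {x v : ℕ → ℂ_[p]}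
    {w : ℂ_[p]} (hx : Tendsto x atTop (𝓝 0)) (hv : Tendsto v atTop (𝓝 w))
    (h : ∀ k, IntSeries.HasValueAt Q (x k) (v k)) :
    w = ((PowerSeries.constantCoeff Q : 𝓞_ℂ_[p]) : ℂ_[p]) :=
  tendsto_nhds_unique hv (intSeries_tendsto_value_of_tendsto_zero hx h)

/-- **Two elements with the same values on points accumulating at `0` have the same value at `𝟙`**:
if `Q` and `Q'` take the SAME values `v k` at points `x k → 0` (e.g. two frames with the same
interpolation data), then `[T⁰]Q = [T⁰]Q'` — so the value at the trivial character of a `Λ`-valued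
frame can be read off ANY object (another frame, or a continuous function on characters) that shares
its values on such a family and is continuous at `𝟙`. [cite: Washington1997, §7.1] -/
theorem intSeries_constantCoeff_eq_of_forall_hasValueAt {Q Q' : PowerSeries 𝓞_ℂ_[p]}
    {x v : ℕ → ℂ_[p]} (hx : Tendsto x atTop (𝓝 0)) (h : ∀ k, IntSeries.HasValueAt Q (x k) (v k))
    (h' : ∀ k, IntSeries.HasValueAt Q' (x k) (v k)) :
    ((PowerSeries.constantCoeff Q : 𝓞_ℂ_[p]) : ℂ_[p]) =
      ((PowerSeries.constantCoeff Q' : 𝓞_ℂ_[p]) : ℂ_[p]) :=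
  tendsto_nhds_unique (intSeries_tendsto_value_of_tendsto_zero hx h)
    (intSeries_tendsto_value_of_tendsto_zero hx h')

end Summit.BirchSwinnertonDyer.Rank1Residual.X11b

end
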